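import Mathlib.Analysis.Complex.Basic
import Mathlib.LinearAlgebra.Matrix.ConjTranspose
import Mathlib.GroupTheory.Perm.Sign
import HarnessLib

/-!
# The moment matrix of a complex `n`-tensor; the determinant and permanent tensors

Support file for the proof of Bürgisser–Ikenmeyer 2017, Cor. 2.9 (`det_n` and `per_n` are
polystable, `Polystability.lean`), Kempf–Ness part. For a complex `n`-tensor
`S : (Fin n → σ) → ℂ` (see `TensorPowerAction.lean`) the **moment matrix** is the `σ × σ` matrix

  `momentMatrix S a b = ∑ k, ∑_{j : j k = a} conj (S (j[k ↦ b])) * S j`,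

the sum over the `n` slots of the one-slot marginals `⟨(E_{ab} acting in slot k) S, S⟩`; up to the
identification `𝔲(σ)^* ≅` Hermitian matrices it is the value at `S` of the moment map of the
unitary group acting on `⊗^n ℂ^σ` (Ness 1984, §1; Kempf–Ness 1979, §1), and its diagonal carries
the weights of the diagonal torus: `∑ a, θ a * momentMatrix S a a = ∑ j, (∑ k, θ (j k)) * |S j|²`
(`sum_mul_momentMatrix_diag`). Its unitary equivariance is proved in
`TensorMomentEquivariance.lean` (it needs the action of `TensorPowerAction.lean`).

The second part defines the tensors behind the generic determinant and permanent: for a class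
function `χ` on `Perm (Fin n)` the **pattern tensor**
`patternTensor χ j = (n!)⁻¹ ∑_{r, τ} [j = (k ↦ (τ (r k), r k))] χ τ` on words
`j : Fin n → Fin n × Fin n` (`detTensor = patternTensor sign`, `perTensor = patternTensor 1`); its
polynomial shadow is `det_n`, resp. `per_n` (proved in `DetPerTensorPoly.lean`). Here we prove the
structural facts used by the Kempf–Ness argument: symmetry under `Perm (Fin n)`
(`patternTensor_comp_perm`), the support (`patternTensor_detPattern`,
`patternTensor_eq_zero_of_forall_ne`), and — the criticality of `det_n`/`per_n`
(Bürgisser–Ikenmeyer 2017, proof of Cor. 2.9: "the support of both `det_n` and `per_n` consists of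
the permutation matrices") in moment-map form — **the moment matrix of a pattern tensor with
unimodular `χ` is scalar** (`exists_momentMatrix_patternTensor_eq_smul_one`).
All statements are [folklore] reformulations; everything is proved.

## References

* G. Kempf, L. Ness, *The length of vectors in representation spaces*, LNM 732 (1979), §1.
* L. Ness (with D. Mumford), *A stratification of the null cone via the moment map*,
  Amer. J. Math. 106 (1984), §1.
* P. Bürgisser, C. Ikenmeyer, *Fundamental invariants of orbit closures*, J. Algebra 477 (2017),
  §2.2, Cor. 2.9. [BurgisserIkenmeyer2017]
-/

noncomputable section

open Finset

namespace Literature.Computability.AlgebraicComplexity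

/-! ### The moment matrix -/

section Moment

variable {σ : Type*} [Fintype σ] [DecidableEq σ] {n : ℕ}

/-- The **moment matrix** of a complex `n`-tensor `S`: entry `(a, b)` is
`∑ k, ∑_{j : j k = a} conj (S (update j k b)) * S j` (sum over the slots of the one-slot
marginals; the moment map of `U(σ)` on `⊗ⁿ ℂ^σ`, Ness 1984 §1). [folklore] -/
def momentMatrix (S : (Fin n → σ) → ℂ) : Matrix σ σ ℂ :=
  fun a b => ∑ k : Fin n, ∑ j : Fin n → σ,
    if j k = a then (starRingEnd ℂ) (S (Function.update j k b)) * S j else 0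

/-- Unfolding `momentMatrix`. [folklore] -/
theorem momentMatrix_apply (S : (Fin n → σ) → ℂ) (a b : σ) :
    momentMatrix S a b = ∑ k : Fin n, ∑ j : Fin n → σ,
      if j k = a then (starRingEnd ℂ) (S (Function.update j k b)) * S j else 0 := rfl

/-- The diagonal of the moment matrix: `momentMatrix S a a = ∑ k, ∑_{j : j k = a} |S j|²`.
[folklore] -/
theorem momentMatrix_apply_self (S : (Fin n → σ) → ℂ) (a : σ) :
    momentMatrix S a a = ∑ k : Fin n, ∑ j : Fin n → σ,
      if j k = a then (((‖S j‖ ^ 2 : ℝ)) : ℂ) else 0 := by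
  rw [momentMatrix_apply]
  refine Finset.sum_congr rfl fun k _ => Finset.sum_congr rfl fun j _ => ?_
  by_cases h : j k = a
  · rw [if_pos h, if_pos h, ← h, Function.update_eq_self, Complex.conj_mul', Complex.ofReal_pow]
  · rw [if_neg h, if_neg h]

/-- The diagonal entries of the moment matrix are real and nonnegative. [folklore] -/
theorem momentMatrix_apply_self_eq_ofReal (S : (Fin n → σ) → ℂ) (a : σ) :
    momentMatrix S a a = ((∑ k : Fin n, ∑ j : Fin n → σ,
      if j k = a then ‖S j‖ ^ 2 else 0 : ℝ) : ℂ) := by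
  rw [momentMatrix_apply_self]
  push_cast
  refine Finset.sum_congr rfl fun k _ => Finset.sum_congr rfl fun j _ => ?_
  split_ifs <;> simp

/-- **The diagonal of the moment matrix computes the torus weights**: for `θ : σ → ℝ`,
`∑ a, θ a * momentMatrix S a a = ∑ j, (∑ k, θ (j k)) * |S j|²` (real form). Ness 1984 §1.
[folklore] -/
theorem sum_mul_momentMatrix_diag (S : (Fin n → σ) → ℂ) (θ : σ → ℝ) :
    ∑ a, θ a * (momentMatrix S a a).re = ∑ j : Fin n → σ, (∑ k, θ (j k)) * ‖S j‖ ^ 2 := by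
  have h : ∀ a, (momentMatrix S a a).re =
      ∑ k : Fin n, ∑ j : Fin n → σ, if j k = a then ‖S j‖ ^ 2 else 0 := by
    intro a
    rw [momentMatrix_apply_self_eq_ofReal, Complex.ofReal_re]
  simp_rw [h, Finset.mul_sum]
  -- `∑ a ∑ k ∑ j [j k = a] θ a |S j|² = ∑ j ∑ k θ (j k) |S j|²`
  rw [Finset.sum_comm]
  conv_rhs => arg 2; ext j; rw [Finset.sum_mul]
  rw [Finset.sum_comm (s := (Finset.univ : Finset (Fin n → σ)))]
  refine Finset.sum_congr rfl fun k _ => ?_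
  rw [Finset.sum_comm]
  refine Finset.sum_congr rfl fun j _ => ?_
  simp_rw [mul_ite, mul_zero]
  rw [Finset.sum_ite_eq Finset.univ (j k) fun a => θ a * ‖S j‖ ^ 2, if_pos (Finset.mem_univ _)]

/-- Complex form of `sum_mul_momentMatrix_diag`. [folklore] -/
theorem sum_mul_momentMatrix_diag' (S : (Fin n → σ) → ℂ) (θ : σ → ℝ) :
    ∑ a, (θ a : ℂ) * momentMatrix S a a = ((∑ j : Fin n → σ, (∑ k, θ (j k)) * ‖S j‖ ^ 2 : ℝ) : ℂ) := by
  rw [← sum_mul_momentMatrix_diag S θ]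
  push_cast
  refine Finset.sum_congr rfl fun a _ => ?_
  rw [momentMatrix_apply_self_eq_ofReal, Complex.ofReal_re]

/-- If the moment matrix of `S` is scalar then all torus weights of `S` balance:
`∑ j, (∑ k, θ (j k)) * |S j|² = 0` whenever `∑ θ = 0`. [folklore] -/
theorem weightSum_eq_zero_of_momentMatrix_eq_smul_one (S : (Fin n → σ) → ℂ) {c : ℂ}
    (hS : momentMatrix S = c • (1 : Matrix σ σ ℂ)) (θ : σ → ℝ) (hθ : ∑ a, θ a = 0) :
    ∑ j : Fin n → σ, (∑ k, θ (j k)) * ‖S j‖ ^ 2 = 0 := by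
  have h := sum_mul_momentMatrix_diag' S θ
  have h2 : ∑ a, (θ a : ℂ) * momentMatrix S a a = 0 := by
    simp_rw [hS, Matrix.smul_apply, Matrix.one_apply_eq, smul_eq_mul, mul_one, ← Finset.sum_mul]
    rw [← Complex.ofReal_sum, hθ]
    simp
  rw [h2] at h
  exact_mod_cast h.symm

end Moment

/-! ### Pattern tensors: the determinant and the permanent as symmetric tensors -/

section Pattern

variable {n : ℕ}

/-- The word of a pair of permutations: `detPattern r τ k = (τ (r k), r k)` — slot `k` carries the
matrix position (row `τ (r k)`, column `r k`); these are the words in the support of the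
determinant and permanent tensors ("the support of `det_n` and `per_n` consists of the
permutation matrices", Bürgisser–Ikenmeyer 2017, proof of Cor. 2.9). [cite: BurgisserIkenmeyer2017, Cor. 2.9] -/
def detPattern (r τ : Equiv.Perm (Fin n)) : Fin n → Fin n × Fin n := fun k => (τ (r k), r k)

/-- Unfolding `detPattern`. [folklore] -/
@[simp]
theorem detPattern_apply (r τ : Equiv.Perm (Fin n)) (k : Fin n) :
    detPattern r τ k = (τ (r k), r k) := rfl

/-- `detPattern` is injective in the pair of permutations. [folklore] -/
theorem detPattern_eq_iff (r τ r' τ' : Equiv.Perm (Fin n)) :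
    detPattern r τ = detPattern r' τ' ↔ r = r' ∧ τ = τ' := by
  constructor
  · intro h
    have hr : r = r' := by
      refine Equiv.ext fun k => ?_
      have := congr_arg Prod.snd (congr_fun h k)
      simpa using this
    subst hr
    refine ⟨rfl, Equiv.ext fun x => ?_⟩
    have := congr_arg Prod.fst (congr_fun h (r.symm x))
    simpa using this
  · rintro ⟨rfl, rfl⟩
    rfl

/-- Precomposing a pattern with a permutation of the slots: `detPattern r τ ∘ π = detPattern (π⁻¹… )`,
precisely `detPattern r τ ∘ π = detPattern (π.trans r) τ`. [folklore] -/
theorem detPattern_comp_perm (r τ π : Equiv.Perm (Fin n)) :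
    detPattern r τ ∘ π = detPattern (π.trans r) τ := by
  funext k
  simp [detPattern]

/-- Two permutations of a finite type agreeing off one point agree. [folklore] -/
theorem _root_.Equiv.Perm.eq_of_apply_eq_off_one {α : Type*} (r r' : Equiv.Perm α) (k : α)
    (h : ∀ m, m ≠ k → r m = r' m) : r = r' := by
  refine Equiv.ext fun m => ?_
  by_cases hm : m = k
  · subst hm
    by_contra hne
    set x := r'.symm (r m) with hx
    have hxm : x ≠ m := by
      intro hxm
      apply hne
      have : r' x = r m := by simp [hx]
      rw [hxm] at this
      exact this.symm
    have h1 := h x hxm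
    have h2 : r' x = r m := by simp [hx]
    rw [h2] at h1
    exact hxm (r.injective h1)
  · exact h m hm

/-- Changing one slot of a pattern word gives a pattern word only trivially: if
`update (detPattern r τ) k b` is again a pattern then `b = detPattern r τ k`. [folklore] -/
theorem eq_of_update_detPattern_eq (r τ r' τ' : Equiv.Perm (Fin n)) (k : Fin n) (b : Fin n × Fin n)
    (h : Function.update (detPattern r τ) k b = detPattern r' τ') : b = detPattern r τ k := by
  have hoff : ∀ m, m ≠ k → detPattern r τ m = detPattern r' τ' m := by
    intro m hm
    have := congr_fun h m
    rwa [Function.update_of_ne hm] at this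
  have hr : r = r' := Equiv.Perm.eq_of_apply_eq_off_one r r' k fun m hm => by
    have := congr_arg Prod.snd (hoff m hm)
    simpa using this
  subst hr
  have hτ : τ = τ' := by
    refine Equiv.Perm.eq_of_apply_eq_off_one τ τ' (r k) fun x hx => ?_
    have hm : r.symm x ≠ k := by
      intro hmk
      apply hx
      rw [← hmk]; simp
    have := congr_arg Prod.fst (hoff (r.symm x) hm)
    simpa using this
  subst hτ
  have := congr_fun h k
  rw [Function.update_self] at this
  exact this

/-- The **pattern tensor** of a coefficient function `χ` on permutations:
`patternTensor χ j = (n!)⁻¹ ∑_{r, τ} [j = detPattern r τ] χ τ`. For `χ = sign` its polynomial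
shadow is `det_n`, for `χ = 1` it is `per_n` (`DetPerTensorPoly.lean`). [folklore] -/
def patternTensor (χ : Equiv.Perm (Fin n) → ℂ) : (Fin n → Fin n × Fin n) → ℂ :=
  fun j => (Nat.factorial n : ℂ)⁻¹ *
    ∑ r : Equiv.Perm (Fin n), ∑ τ : Equiv.Perm (Fin n), if j = detPattern r τ then χ τ else 0

/-- Unfolding `patternTensor`. [folklore] -/
theorem patternTensor_apply (χ : Equiv.Perm (Fin n) → ℂ) (j : Fin n → Fin n × Fin n) :
    patternTensor χ j = (Nat.factorial n : ℂ)⁻¹ *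
      ∑ r : Equiv.Perm (Fin n), ∑ τ : Equiv.Perm (Fin n),
        if j = detPattern r τ then χ τ else 0 := rfl

/-- The **determinant tensor**: the symmetric `n`-tensor on `Fin n × Fin n` whose polynomial
shadow is the generic determinant `det_n` (`patternTensor` with `χ = sign`). [folklore] -/
def detTensor (n : ℕ) : (Fin n → Fin n × Fin n) → ℂ :=
  patternTensor fun τ => ((Equiv.Perm.sign τ : ℤ) : ℂ)

/-- The **permanent tensor**: the symmetric `n`-tensor on `Fin n × Fin n` whose polynomial shadow
is the generic permanent `per_n` (`patternTensor` with `χ = 1`). [folklore] -/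
def perTensor (n : ℕ) : (Fin n → Fin n × Fin n) → ℂ :=
  patternTensor fun _ => 1

/-- The value of a pattern tensor on a pattern word. [folklore] -/
theorem patternTensor_detPattern (χ : Equiv.Perm (Fin n) → ℂ) (r τ : Equiv.Perm (Fin n)) :
    patternTensor χ (detPattern r τ) = (Nat.factorial n : ℂ)⁻¹ * χ τ := by
  rw [patternTensor_apply]
  congr 1
  have h : ∀ r' τ' : Equiv.Perm (Fin n),
      (if detPattern r τ = detPattern r' τ' then χ τ' else 0) =
        if r = r' then (if τ = τ' then χ τ' else 0) else 0 := by
    intro r' τ'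
    by_cases hr : r = r' <;> by_cases hτ : τ = τ' <;> simp [hr, hτ, detPattern_eq_iff]
  simp_rw [h]
  rw [Finset.sum_comm]
  simp_rw [Finset.sum_ite_eq Finset.univ r, if_pos (Finset.mem_univ _)]
  rw [Finset.sum_ite_eq Finset.univ τ, if_pos (Finset.mem_univ _)]

/-- A pattern tensor vanishes off the pattern words. [folklore] -/
theorem patternTensor_eq_zero_of_forall_ne (χ : Equiv.Perm (Fin n) → ℂ)
    {j : Fin n → Fin n × Fin n} (hj : ∀ r τ, j ≠ detPattern r τ) : patternTensor χ j = 0 := by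
  rw [patternTensor_apply]
  simp [if_neg (hj _ _)]

/-- A word on which a pattern tensor is nonzero is a pattern word. [folklore] -/
theorem exists_eq_detPattern_of_patternTensor_ne_zero (χ : Equiv.Perm (Fin n) → ℂ)
    {j : Fin n → Fin n × Fin n} (hj : patternTensor χ j ≠ 0) : ∃ r τ, j = detPattern r τ := by
  by_contra h
  push Not at h
  exact hj (patternTensor_eq_zero_of_forall_ne χ h)

/-- **Pattern tensors are symmetric** under permutations of the slots. [folklore] -/
theorem patternTensor_comp_perm (χ : Equiv.Perm (Fin n) → ℂ) (j : Fin n → Fin n × Fin n)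
    (π : Equiv.Perm (Fin n)) : patternTensor χ (j ∘ π) = patternTensor χ j := by
  rw [patternTensor_apply, patternTensor_apply]
  congr 1
  -- reindex `r ↦ π.trans r`
  refine Fintype.sum_equiv (Equiv.mulRight π⁻¹) _ _ fun r => ?_
  refine Finset.sum_congr rfl fun τ _ => ?_
  have hiff : j ∘ π = detPattern r τ ↔ j = detPattern (Equiv.mulRight π⁻¹ r) τ := by
    rw [Equiv.coe_mulRight]
    constructor
    · intro h
      have : j = (j ∘ π) ∘ π.symm := by
        funext k; simp
      rw [this, h, detPattern_comp_perm]
      rfl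
    · intro h
      rw [h, detPattern_comp_perm]
      congr 1
      ext k
      simp [Equiv.Perm.mul_apply]
  exact if_congr hiff rfl rfl

/-- The squared norm of a pattern tensor with unimodular `χ`, as an indicator sum over the
patterns: `|patternTensor χ j|² = (n!)⁻² ∑_{r,τ} [j = detPattern r τ]`. [folklore] -/
theorem norm_sq_patternTensor (χ : Equiv.Perm (Fin n) → ℂ) (hχ : ∀ τ, ‖χ τ‖ = 1)
    (j : Fin n → Fin n × Fin n) :
    ‖patternTensor χ j‖ ^ 2 = ((Nat.factorial n : ℝ)⁻¹) ^ 2 *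
      ∑ r : Equiv.Perm (Fin n), ∑ τ : Equiv.Perm (Fin n),
        if j = detPattern r τ then (1 : ℝ) else 0 := by
  by_cases h : ∃ r τ, j = detPattern r τ
  · obtain ⟨r, τ, rfl⟩ := h
    rw [patternTensor_detPattern, norm_mul, norm_inv, Complex.norm_natCast, hχ, mul_one]
    have hs : (∑ r' : Equiv.Perm (Fin n), ∑ τ' : Equiv.Perm (Fin n),
        if detPattern r τ = detPattern r' τ' then (1 : ℝ) else 0) = 1 := by
      have h2 : ∀ r' τ' : Equiv.Perm (Fin n),
          (if detPattern r τ = detPattern r' τ' then (1 : ℝ) else 0) =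
            if r = r' then (if τ = τ' then 1 else 0) else 0 := by
        intro r' τ'
        by_cases hr : r = r' <;> by_cases hτ : τ = τ' <;> simp [hr, hτ, detPattern_eq_iff]
      simp_rw [h2]
      rw [Finset.sum_comm]
      simp_rw [Finset.sum_ite_eq Finset.univ r, if_pos (Finset.mem_univ _)]
      rw [Finset.sum_ite_eq Finset.univ τ, if_pos (Finset.mem_univ _)]
    rw [hs, mul_one]
  · push Not at h
    rw [patternTensor_eq_zero_of_forall_ne χ h, norm_zero]
    have hs : (∑ r' : Equiv.Perm (Fin n), ∑ τ' : Equiv.Perm (Fin n),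
        if j = detPattern r' τ' then (1 : ℝ) else 0) = 0 :=
      Finset.sum_eq_zero fun r' _ => Finset.sum_eq_zero fun τ' _ => if_neg (h r' τ')
    rw [hs]
    simp

/-- The number of permutations of `Fin n` sending `x` to `y` does not depend on `(x, y)`
(conjugate by transpositions). [folklore] -/
theorem sum_ite_perm_apply_eq (x y x' y' : Fin n) :
    (∑ π : Equiv.Perm (Fin n), if π x = y then (1 : ℝ) else 0) =
      ∑ π : Equiv.Perm (Fin n), if π x' = y' then (1 : ℝ) else 0 := by
  -- `π ↦ swap y y' * π * swap x x'` matches the two conditions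
  refine Fintype.sum_equiv ((Equiv.mulRight (Equiv.swap x x')).trans
    (Equiv.mulLeft (Equiv.swap y y'))) _ _ fun π => ?_
  have hx : (Equiv.swap y y' * (π * Equiv.swap x x')) x' = Equiv.swap y y' (π x) := by
    simp [Equiv.Perm.mul_apply, Equiv.swap_apply_right]
  show (if π x = y then (1 : ℝ) else 0) =
    if (Equiv.swap y y' * (π * Equiv.swap x x')) x' = y' then 1 else 0
  rw [hx]
  have hiff : π x = y ↔ Equiv.swap y y' (π x) = y' := by
    constructor
    · intro h; rw [h, Equiv.swap_apply_left]
    · intro h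
      have := congr_arg (Equiv.swap y y') h
      rwa [Equiv.swap_apply_self, Equiv.swap_apply_right] at this
  exact if_congr hiff rfl rfl

/-! ### The moment matrix of a pattern tensor is scalar -/

/-- Off-diagonal entries of the moment matrix of a pattern tensor vanish: two pattern words
differing in one slot are equal. [folklore] -/
theorem momentMatrix_patternTensor_apply_of_ne (χ : Equiv.Perm (Fin n) → ℂ) {a b : Fin n × Fin n}
    (hab : a ≠ b) : momentMatrix (patternTensor χ) a b = 0 := by
  rw [momentMatrix_apply]
  refine Finset.sum_eq_zero fun k _ => Finset.sum_eq_zero fun j _ => ?_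
  by_cases hjk : j k = a
  · rw [if_pos hjk]
    by_cases hT : patternTensor χ j = 0
    · rw [hT, mul_zero]
    by_cases hT' : patternTensor χ (Function.update j k b) = 0
    · rw [hT', map_zero, zero_mul]
    exfalso
    obtain ⟨r, τ, hj⟩ := exists_eq_detPattern_of_patternTensor_ne_zero χ hT
    obtain ⟨r', τ', hj'⟩ := exists_eq_detPattern_of_patternTensor_ne_zero χ hT'
    subst hj
    have hb := eq_of_update_detPattern_eq r τ r' τ' k b hj'
    exact hab (hjk.symm.trans hb.symm)
  · rw [if_neg hjk]

/-- The diagonal entries of the moment matrix of a pattern tensor with unimodular `χ` do not depend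
on the entry: `momentMatrix (patternTensor χ) a a = (n!)⁻² ∑ k, (#{π | π k = k})²`. [folklore] -/
theorem momentMatrix_patternTensor_apply_self (χ : Equiv.Perm (Fin n) → ℂ) (hχ : ∀ τ, ‖χ τ‖ = 1)
    (a : Fin n × Fin n) :
    momentMatrix (patternTensor χ) a a = ((((Nat.factorial n : ℝ)⁻¹) ^ 2 *
      ∑ k : Fin n, ((∑ π : Equiv.Perm (Fin n), if π k = k then (1 : ℝ) else 0) *
        ∑ π : Equiv.Perm (Fin n), if π k = k then (1 : ℝ) else 0) : ℝ) : ℂ) := by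
  rw [momentMatrix_apply_self_eq_ofReal]
  congr 1
  simp_rw [norm_sq_patternTensor χ hχ]
  rw [Finset.mul_sum]
  refine Finset.sum_congr rfl fun k _ => ?_
  -- `∑_j [j k = a] (c * ∑_{r,τ} [j = p r τ]) = c * ∑_{r,τ} [p r τ k = a]`
  have h1 : (∑ j : Fin n → Fin n × Fin n, if j k = a then
      ((Nat.factorial n : ℝ)⁻¹) ^ 2 * ∑ r : Equiv.Perm (Fin n), ∑ τ : Equiv.Perm (Fin n),
        (if j = detPattern r τ then (1 : ℝ) else 0) else 0) =
      ((Nat.factorial n : ℝ)⁻¹) ^ 2 * ∑ r : Equiv.Perm (Fin n), ∑ τ : Equiv.Perm (Fin n),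
        if detPattern r τ k = a then (1 : ℝ) else 0 := by
    set c : ℝ := ((Nat.factorial n : ℝ)⁻¹) ^ 2 with hc
    have hpush : ∀ j : Fin n → Fin n × Fin n,
        (if j k = a then c * ∑ r : Equiv.Perm (Fin n), ∑ τ : Equiv.Perm (Fin n),
          (if j = detPattern r τ then (1 : ℝ) else 0) else 0) =
          ∑ r : Equiv.Perm (Fin n), ∑ τ : Equiv.Perm (Fin n),
            c * (if j k = a ∧ j = detPattern r τ then (1 : ℝ) else 0) := by
      intro j
      by_cases hj : j k = a
      · rw [if_pos hj, Finset.mul_sum]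
        refine Finset.sum_congr rfl fun r _ => ?_
        rw [Finset.mul_sum]
        refine Finset.sum_congr rfl fun τ _ => ?_
        simp [hj]
      · rw [if_neg hj]
        symm
        exact Finset.sum_eq_zero fun r _ => Finset.sum_eq_zero fun τ _ => by simp [hj]
    simp_rw [hpush]
    rw [Finset.sum_comm, Finset.mul_sum]
    refine Finset.sum_congr rfl fun r _ => ?_
    rw [Finset.sum_comm, Finset.mul_sum]
    refine Finset.sum_congr rfl fun τ _ => ?_
    rw [← Finset.mul_sum]
    congr 1
    rw [Finset.sum_eq_single (detPattern r τ)]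
    · by_cases h : detPattern r τ k = a
      · rw [if_pos ⟨h, rfl⟩, if_pos h]
      · rw [if_neg fun h' => h h'.1, if_neg h]
    · intro j _ hj
      rw [if_neg fun h' => hj h'.2]
    · intro h; exact absurd (Finset.mem_univ _) h
  rw [h1]
  congr 1
  -- `∑_{r,τ} [(τ (r k), r k) = a] = #{r | r k = a.2} * #{τ | τ a.2 = a.1}`
  have h2 : ∀ r τ : Equiv.Perm (Fin n), (if detPattern r τ k = a then (1 : ℝ) else 0) =
      (if r k = a.2 then 1 else 0) * (if τ a.2 = a.1 then 1 else 0) := by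
    intro r τ
    rw [detPattern_apply]
    by_cases hr : r k = a.2
    · rw [if_pos hr, one_mul, hr]
      by_cases hτ : τ a.2 = a.1
      · rw [if_pos hτ, if_pos (show (τ a.2, a.2) = a from Prod.ext hτ rfl)]
      · rw [if_neg hτ, if_neg fun h => hτ (congr_arg Prod.fst h)]
    · rw [if_neg hr, zero_mul, if_neg fun h => hr (congr_arg Prod.snd h)]
  simp_rw [h2, ← Finset.mul_sum, ← Finset.sum_mul]
  rw [sum_ite_perm_apply_eq k a.2 k k, sum_ite_perm_apply_eq a.2 a.1 k k]

/-- **The moment matrix of a pattern tensor with unimodular `χ` is scalar** — the moment-map form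
of the criticality of `det_n` and `per_n` ("the support of both `det_n` and `per_n` consists of the
permutation matrices", Bürgisser–Ikenmeyer 2017, proof of Cor. 2.9; Kempf–Ness 1979, Thm. 0.2).
[cite: BurgisserIkenmeyer2017, Cor. 2.9] -/
theorem exists_momentMatrix_patternTensor_eq_smul_one (χ : Equiv.Perm (Fin n) → ℂ)
    (hχ : ∀ τ, ‖χ τ‖ = 1) :
    ∃ c : ℂ, momentMatrix (patternTensor χ) = c • (1 : Matrix (Fin n × Fin n) (Fin n × Fin n) ℂ) := by
  refine ⟨((((Nat.factorial n : ℝ)⁻¹) ^ 2 *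
      ∑ k : Fin n, ((∑ π : Equiv.Perm (Fin n), if π k = k then (1 : ℝ) else 0) *
        ∑ π : Equiv.Perm (Fin n), if π k = k then (1 : ℝ) else 0) : ℝ) : ℂ), ?_⟩
  ext a b
  rw [Matrix.smul_apply, smul_eq_mul]
  by_cases hab : a = b
  · subst hab
    rw [Matrix.one_apply_eq, mul_one, momentMatrix_patternTensor_apply_self χ hχ]
  · rw [Matrix.one_apply_ne hab, mul_zero, momentMatrix_patternTensor_apply_of_ne χ hab]

/-- The determinant tensor has scalar moment matrix (criticality of `det_n`).
[cite: BurgisserIkenmeyer2017, Cor. 2.9] -/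
theorem exists_momentMatrix_detTensor_eq_smul_one (n : ℕ) :
    ∃ c : ℂ, momentMatrix (detTensor n) = c • (1 : Matrix (Fin n × Fin n) (Fin n × Fin n) ℂ) :=
  exists_momentMatrix_patternTensor_eq_smul_one _ fun τ => by
    rcases Int.units_eq_one_or (Equiv.Perm.sign τ) with h | h <;> simp [h]

/-- The permanent tensor has scalar moment matrix (criticality of `per_n`).
[cite: BurgisserIkenmeyer2017, Cor. 2.9] -/
theorem exists_momentMatrix_perTensor_eq_smul_one (n : ℕ) :
    ∃ c : ℂ, momentMatrix (perTensor n) = c • (1 : Matrix (Fin n × Fin n) (Fin n × Fin n) ℂ) :=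
  exists_momentMatrix_patternTensor_eq_smul_one _ fun _ => by simp

end Pattern

end Literature.Computability.AlgebraicComplexity
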